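import Literature.InformationTheory.QuantumCodes.QuantumExpanderLTZLemma8WeightSharp
import Literature.InformationTheory.QuantumCodes.QuantumExpanderRobustnessThird
import Literature.InformationTheory.QuantumCodes.QuantumExpanderZSector
import HarnessLib

/-!
# Robustness of quantum expander codes with the printed constant `1/3` at radius `(9/10)·min(γ_A n_A, γ_B n_B)`,
# all degrees (LTZ15 Cor 9, repaired) — PROOF

Index of sources: `[cite: LeverrierTillichZemor2015]` = Leverrier–Tillich–Zémor, FOCS 2015 / arXiv:1504.00822v1, Cor 9
"Robustness" (p0009 L9-11) and its proof (p0009 L13-31: iterate Lemma 8 inside the ball `w_R < min(γ_A n_A, γ_B n_B)`).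

qec PARTITION v2 row 04 (`prover-qec-type-04`, gen 6), item «E-7b sharp radius». Sequel to
`QuantumExpanderRobustnessThird.lean` (radius `3R/5` from the weak clause) using the SHARP weight clause of
`QuantumExpanderLTZLemma8WeightSharp.lean` (`3·w_R(e+e₁) ≤ 3·w_R(e) + decrease`): the potential `3·w_R + |σ_X|` does not
increase along the printed iteration, so the iteration stays in the Lemma-8 ball as soon as `3·w_R(e) + |σ_X(e)| ≤ 3R`
(`R = min(γ_A n_A, γ_B n_B)`); if `3|σ_X(e)| < w_R(e)` this holds whenever `w_R(e) ≤ (9/10)R`. With "`|σ_X(e)| ≥ w_R(e)/3`"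
phrased as "some word of `e + C_Z^⊥` has weight `≤ 3|σ_X(e)|`":

* `ltz15_corollary9_sharp` — `3·w_R(e) + |σ_X(e)| ≤ 3R ⟹ |σ_X(e)| ≥ w_R(e)/3`, all `(Δ_A, Δ_B)`;
* `ltz15_corollary9_nine_tenths` — `w_R(e) ≤ (9/10)·R ⟹ |σ_X(e)| ≥ w_R(e)/3`, all `(Δ_A, Δ_B)`;
* `ltz15_corollary9_near_balanced_zsector`, `ltz15_corollary9_nine_tenths_zsector` — the same two robustness statements
  for `Z`-errors of `Q_G` (syndrome `H_Z`, cosets of `rowsp H_X`), i.e. the `X`-sector statements for `Gᵀ` transported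
  along the block swap ("exchanging the roles of `A` and `B`").

HONEST FRAMING: OURS, not the printed statement (printed: radius `R`, proved in the tree only for `|Δ_A − Δ_B| ≤ 5`,
`ltz15_corollary9_near_balanced`). `9/10` is the limit of this potential method: the worst-case ratio deficit/decrease of
App. B's bounds tends to `1/3` (qec cell note E7-REPAIR.md), and a potential `w_R + λ|σ_X|` needs `λ ≥` that ratio, giving
radius `3R/(3+λ) ≤ 9R/10`. PROVED (kernel axioms); no definitions, no named facts.
-/

namespace Literature.InformationTheory.QuantumCodes

namespace QuantumExpander

open Finset Matrix

variable {A B : Type*} [Fintype A] [Fintype B] [DecidableEq A] [DecidableEq B]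

/-- The printed iteration with the potential `3|·| + |σ_X(·)|` (all degrees): every word `f` with
`3|f| + |σ_X(f)| ≤ 3R` (`R = min(γ_A n_A, γ_B n_B)`) has a coset word of weight `≤ 3|σ_X(f)|`. Induction on `|σ_X(f)|`; the
step is Lemma 8 with the sharp clause (`exists_smallSet_decrease_third_weight_sharp`), under which the potential does not
increase. STATUS: OURS, not the printed statement. [cite: LeverrierTillichZemor2015, Cor 9 proof (arXiv v1 p0009 L13-31)] -/
theorem ltz15_corollary9_sharp_self (H : Matrix B A (ZMod 2)) {dA dB : ℕ} {γA δA γB δB : ℝ}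
    (hreg : IsBiregular H dA dB) (hexp : IsLeftRightExpanding H dA dB γA δA γB δB)
    (hdA : 0 < dA) (hdB : 0 < dB) (hδA : 0 < δA) (hδA' : δA < 1 / 6) (hδB : 0 < δB) (hδB' : δB < 1 / 6)
    (n : ℕ) :
    ∀ f : (A × A) ⊕ (B × B) → ZMod 2, hammingNorm (expanderHX H *ᵥ f) ≤ n →
      3 * (hammingNorm f : ℝ) + hammingNorm (expanderHX H *ᵥ f)
          ≤ 3 * min (γA * Fintype.card A) (γB * Fintype.card B) →
      ∃ f' : (A × A) ⊕ (B × B) → ZMod 2, f' + f ∈ rowSpace (expanderHZ H) ∧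
        hammingNorm f' ≤ 3 * hammingNorm (expanderHX H *ᵥ f) := by
  induction n with
  | zero =>
    intro f hσ hpot
    have h0 : expanderHX H *ᵥ f = 0 := by rwa [Nat.le_zero, hammingNorm_eq_zero] at hσ
    have hw : (hammingNorm f : ℝ) ≤ min (γA * Fintype.card A) (γB * Fintype.card B) := by
      have : (0 : ℝ) ≤ hammingNorm (expanderHX H *ᵥ f) := Nat.cast_nonneg _
      linarith
    exact exists_coset_word_of_syndrome_eq_zero H hreg hexp hdA hdB hδA' hδB' h0 hw
  | succ n ih =>
    intro f hσ hpot
    have hw : (hammingNorm f : ℝ) ≤ min (γA * Fintype.card A) (γB * Fintype.card B) := by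
      have : (0 : ℝ) ≤ hammingNorm (expanderHX H *ᵥ f) := Nat.cast_nonneg _
      linarith
    by_cases h0 : expanderHX H *ᵥ f = 0
    · exact exists_coset_word_of_syndrome_eq_zero H hreg hexp hdA hdB hδA' hδB' h0 hw
    · have hnot : f ∉ rowSpace (expanderHZ H) := fun h => h0 (expanderHX_mulVec_eq_zero_of_mem_rowSpace H h)
      obtain ⟨F, hF, e', hF3, he', hwt, -⟩ := exists_smallSet_decrease_third_weight_sharp H hreg hexp hdA hdB hδA
        hδA' hδB hδB' f hnot (hw.trans (min_le_left _ _)) (hw.trans (min_le_right _ _))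
      obtain ⟨hsyn, hwtσ, hdec1⟩ := syndrome_step_bookkeeping H hF hF3 he'
      set dec := syndromeDecrease (expanderHX H) (expanderHX H *ᵥ f) F with hdec
      have hwtσR : (hammingNorm (expanderHX H *ᵥ e') : ℝ) = hammingNorm (expanderHX H *ᵥ f) - dec := by
        exact_mod_cast hwtσ
      have hσ' : hammingNorm (expanderHX H *ᵥ e') ≤ n := by
        have h1 : (hammingNorm (expanderHX H *ᵥ e') : ℤ) ≤ (n + 1 : ℕ) - 1 := by
          rw [hwtσ]; push_cast
          have : (hammingNorm (expanderHX H *ᵥ f) : ℤ) ≤ (n + 1 : ℕ) := by exact_mod_cast hσ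
          push_cast at this; linarith
        have h2 : (hammingNorm (expanderHX H *ᵥ e') : ℤ) ≤ n := by push_cast at h1; linarith
        exact_mod_cast h2
      have hpot' : 3 * (hammingNorm e' : ℝ) + hammingNorm (expanderHX H *ᵥ e')
          ≤ 3 * min (γA * Fintype.card A) (γB * Fintype.card B) := by linarith
      obtain ⟨f'', hf'', hwf''⟩ := ih e' hσ' hpot'
      refine ⟨f'' + flipVec F, ?_, ?_⟩
      · have : f'' + flipVec F + f = (f'' + e') - (e' - (f + flipVec F)) := by abel
        rw [this]; exact Submodule.sub_mem _ hf'' he'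
      · have h1 : hammingNorm (f'' + flipVec F) ≤ hammingNorm f'' + F.card := by
          have := hammingNorm_add_flipVec f'' F; omega
        have h2 : (hammingNorm (f'' + flipVec F) : ℝ) ≤ 3 * hammingNorm (expanderHX H *ᵥ f) := by
          have h1' : (hammingNorm (f'' + flipVec F) : ℝ) ≤ hammingNorm f'' + F.card := by exact_mod_cast h1
          have h3 : (hammingNorm f'' : ℝ) ≤ 3 * hammingNorm (expanderHX H *ᵥ e') := by exact_mod_cast hwf''
          rw [hwtσR] at h3
          linarith
        exact_mod_cast h2

/-- **Robustness with constant `1/3`, sharp potential form, all degrees**: for a `(Δ_A,Δ_B)`-biregular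
`(γ_A,δ_A,γ_B,δ_B)`-expander with `δ_A, δ_B < 1/6` and any `Δ_A, Δ_B ≥ 1`: if `e + C_Z^⊥` contains a word `e₀` with
`3|e₀| + |σ_X(e)| ≤ 3R` (`R = min(γ_A n_A, γ_B n_B)`), it contains a word of weight `≤ 3|σ_X(e)|` (i.e. `|σ_X(e)| ≥ w_R(e)/3`).
STATUS: OURS, NOT the printed statement. [cite: LeverrierTillichZemor2015, Cor 9 and its proof (arXiv v1 p0009 L9-31)] -/
theorem ltz15_corollary9_sharp (H : Matrix B A (ZMod 2)) {dA dB : ℕ} {γA δA γB δB : ℝ}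
    (hreg : IsBiregular H dA dB) (hexp : IsLeftRightExpanding H dA dB γA δA γB δB)
    (hdA : 0 < dA) (hdB : 0 < dB) (hδA : 0 < δA) (hδA' : δA < 1 / 6) (hδB : 0 < δB) (hδB' : δB < 1 / 6)
    {e e₀ : (A × A) ⊕ (B × B) → ZMod 2} (he₀ : e₀ + e ∈ rowSpace (expanderHZ H))
    (hpot : 3 * (hammingNorm e₀ : ℝ) + hammingNorm (expanderHX H *ᵥ e)
      ≤ 3 * min (γA * Fintype.card A) (γB * Fintype.card B)) :
    ∃ e' : (A × A) ⊕ (B × B) → ZMod 2, e' + e ∈ rowSpace (expanderHZ H) ∧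
      hammingNorm e' ≤ 3 * hammingNorm (expanderHX H *ᵥ e) := by
  have hsyn := (coset_transfer H he₀ (f' := e₀) (by
    have : e₀ + e₀ = 0 := by
      funext q; simp only [Pi.add_apply, Pi.zero_apply]; exact (by decide : ∀ z : ZMod 2, z + z = 0) _
    rw [this]; exact Submodule.zero_mem _)).1
  rw [← hsyn] at hpot
  obtain ⟨f', hf', hwf'⟩ := ltz15_corollary9_sharp_self H hreg hexp hdA hdB hδA hδA' hδB hδB' _ e₀ le_rfl hpot
  obtain ⟨-, hmem⟩ := coset_transfer H he₀ hf'
  exact ⟨f', hmem, by rw [← hsyn]; exact hwf'⟩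

/-- **Robustness with constant `1/3` at radius `(9/10)·min(γ_A n_A, γ_B n_B)`, all degrees**: for a
`(Δ_A,Δ_B)`-biregular `(γ_A,δ_A,γ_B,δ_B)`-expander with `δ_A, δ_B < 1/6` and any `Δ_A, Δ_B ≥ 1`, if `e + C_Z^⊥` contains a
word `e₀` with `|e₀| ≤ (9/10)·min(γ_A n_A, γ_B n_B)` then it contains a word of weight `≤ 3|σ_X(e)|`, i.e.
`|σ_X(e)| ≥ w_R(e)/3`. (If `3|σ_X(e)| ≥ |e₀|` take `e₀`; else `3|e₀| + |σ_X(e)| < (10/3)|e₀| ≤ 3R`.) STATUS: OURS, NOT the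
printed statement — constant `1/3` as printed, radius `9R/10` instead of the printed `R` (which the tree has only for
`|Δ_A − Δ_B| ≤ 5`, `ltz15_corollary9_near_balanced`). [cite: LeverrierTillichZemor2015, Cor 9 (arXiv v1 p0009 L9-11)] -/
theorem ltz15_corollary9_nine_tenths (H : Matrix B A (ZMod 2)) {dA dB : ℕ} {γA δA γB δB : ℝ}
    (hreg : IsBiregular H dA dB) (hexp : IsLeftRightExpanding H dA dB γA δA γB δB)
    (hdA : 0 < dA) (hdB : 0 < dB) (hδA : 0 < δA) (hδA' : δA < 1 / 6) (hδB : 0 < δB) (hδB' : δB < 1 / 6)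
    {e e₀ : (A × A) ⊕ (B × B) → ZMod 2} (he₀ : e₀ + e ∈ rowSpace (expanderHZ H))
    (hw : (hammingNorm e₀ : ℝ) ≤ 9 / 10 * min (γA * Fintype.card A) (γB * Fintype.card B)) :
    ∃ e' : (A × A) ⊕ (B × B) → ZMod 2, e' + e ∈ rowSpace (expanderHZ H) ∧
      hammingNorm e' ≤ 3 * hammingNorm (expanderHX H *ᵥ e) := by
  by_cases h3 : hammingNorm e₀ ≤ 3 * hammingNorm (expanderHX H *ᵥ e)
  · exact ⟨e₀, he₀, h3⟩
  · push Not at h3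
    have h3R : (3 * hammingNorm (expanderHX H *ᵥ e) : ℝ) < hammingNorm e₀ := by exact_mod_cast h3
    refine ltz15_corollary9_sharp H hreg hexp hdA hdB hδA hδA' hδB hδB' he₀ ?_
    linarith

/-! ### The `Z`-sector (exchange the roles of `A` and `B`) -/

/-- **LTZ15 Corollary 9 for `Z`-errors, as printed, near-balanced degrees**: for a `(Δ_A,Δ_B)`-biregular
`(γ_A,δ_A,γ_B,δ_B)`-expander with `δ_A, δ_B < 1/6` and `|Δ_A − Δ_B| ≤ 5`, if the coset `e + rowsp H_X` of a `Z`-error `e`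
contains a word of weight `< min(γ_A n_A, γ_B n_B)`, it contains a word of weight `≤ 3|σ_Z(e)|` (`σ_Z(e) = H_Z e`). The
`X`-sector statement `ltz15_corollary9_near_balanced` for `Gᵀ`, transported along the block swap
(`expanderHX_eq_submatrix_swap`, `expanderHZ_eq_submatrix_swap`). STATUS: PRINTED statement ("`|σ(e)| ≥ w_R(e)/3`", the
`Z`-case by "exchanging the roles of `A` and `B`") under the ADDED hypothesis `|Δ_A − Δ_B| ≤ 5`.
[cite: LeverrierTillichZemor2015, Cor 9 (arXiv v1 p0009 L9-11) with §2 ("the situation for 𝒢_Z is obtained by exchanging the roles of A and B"; p0005)] -/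
theorem ltz15_corollary9_near_balanced_zsector (H : Matrix B A (ZMod 2)) {dA dB : ℕ} {γA δA γB δB : ℝ}
    (hreg : IsBiregular H dA dB) (hexp : IsLeftRightExpanding H dA dB γA δA γB δB)
    (hdA : 0 < dA) (hdB : 0 < dB) (hδA : 0 < δA) (hδA' : δA < 1 / 6) (hδB : 0 < δB) (hδB' : δB < 1 / 6)
    (hbal : |(dA : ℝ) - dB| ≤ 5)
    {e e₀ : (A × A) ⊕ (B × B) → ZMod 2} (he₀ : e₀ + e ∈ rowSpace (expanderHX H))
    (hw : (hammingNorm e₀ : ℝ) < min (γA * Fintype.card A) (γB * Fintype.card B)) :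
    ∃ e' : (A × A) ⊕ (B × B) → ZMod 2, e' + e ∈ rowSpace (expanderHX H) ∧
      hammingNorm e' ≤ 3 * hammingNorm (expanderHZ H *ᵥ e) := by
  set σ := Equiv.sumComm (A × A) (B × B) with hσ
  rw [expanderHX_eq_submatrix_swap H] at he₀ ⊢
  rw [expanderHZ_eq_submatrix_swap H, mem_rowSpace_submatrix_iff] at *
  have hregT : IsBiregular Hᵀ dB dA := isBiregular_transpose H hreg
  have hexpT : IsLeftRightExpanding Hᵀ dB dA γB δB γA δA := by
    refine ⟨(isLeftExpanding_transpose_iff H dB γB δB).2 hexp.2, ?_⟩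
    have h : IsLeftExpanding Hᵀᵀ dA γA δA := by rw [Matrix.transpose_transpose]; exact hexp.1
    exact (isLeftExpanding_transpose_iff Hᵀ dA γA δA).1 h
  have hbalT : |(dB : ℝ) - dA| ≤ 5 := by rwa [abs_sub_comm]
  have he₀' : e₀ ∘ σ.symm + e ∘ σ.symm ∈ rowSpace (expanderHZ Hᵀ) := he₀
  have hw' : (hammingNorm (e₀ ∘ σ.symm) : ℝ) < min (γB * Fintype.card B) (γA * Fintype.card A) := by
    rw [hammingNorm_comp_equiv, min_comm]; exact hw
  obtain ⟨f', hf', hwf'⟩ := ltz15_corollary9_near_balanced Hᵀ hregT hexpT hdB hdA hδB hδB' hδA hδA' hbalT he₀' hw'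
  refine ⟨f' ∘ σ, ?_, ?_⟩
  · rw [mem_rowSpace_submatrix_iff]
    have : (f' ∘ σ + e) ∘ σ.symm = f' + e ∘ σ.symm := by
      funext q; simp [Function.comp_apply]
    rw [this]; exact hf'
  · rw [submatrix_mulVec_eq]
    have : hammingNorm (f' ∘ ⇑σ) = hammingNorm f' := by
      have h := hammingNorm_comp_equiv (f' ∘ σ) σ
      rw [← h]; congr 1; funext q; simp
    rw [this]; exact hwf'

/-- **Robustness for `Z`-errors with constant `1/3` at radius `(9/10)·min(γ_A n_A, γ_B n_B)`, all degrees**: the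
`X`-sector statement `ltz15_corollary9_nine_tenths` for `Gᵀ`, transported along the block swap. STATUS: OURS, NOT the
printed statement. [cite: LeverrierTillichZemor2015, Cor 9 (arXiv v1 p0009 L9-11) with §2 (exchange of A and B; p0005)] -/
theorem ltz15_corollary9_nine_tenths_zsector (H : Matrix B A (ZMod 2)) {dA dB : ℕ} {γA δA γB δB : ℝ}
    (hreg : IsBiregular H dA dB) (hexp : IsLeftRightExpanding H dA dB γA δA γB δB)
    (hdA : 0 < dA) (hdB : 0 < dB) (hδA : 0 < δA) (hδA' : δA < 1 / 6) (hδB : 0 < δB) (hδB' : δB < 1 / 6)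
    {e e₀ : (A × A) ⊕ (B × B) → ZMod 2} (he₀ : e₀ + e ∈ rowSpace (expanderHX H))
    (hw : (hammingNorm e₀ : ℝ) ≤ 9 / 10 * min (γA * Fintype.card A) (γB * Fintype.card B)) :
    ∃ e' : (A × A) ⊕ (B × B) → ZMod 2, e' + e ∈ rowSpace (expanderHX H) ∧
      hammingNorm e' ≤ 3 * hammingNorm (expanderHZ H *ᵥ e) := by
  set σ := Equiv.sumComm (A × A) (B × B) with hσ
  rw [expanderHX_eq_submatrix_swap H] at he₀ ⊢
  rw [expanderHZ_eq_submatrix_swap H, mem_rowSpace_submatrix_iff] at *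
  have hregT : IsBiregular Hᵀ dB dA := isBiregular_transpose H hreg
  have hexpT : IsLeftRightExpanding Hᵀ dB dA γB δB γA δA := by
    refine ⟨(isLeftExpanding_transpose_iff H dB γB δB).2 hexp.2, ?_⟩
    have h : IsLeftExpanding Hᵀᵀ dA γA δA := by rw [Matrix.transpose_transpose]; exact hexp.1
    exact (isLeftExpanding_transpose_iff Hᵀ dA γA δA).1 h
  have he₀' : e₀ ∘ σ.symm + e ∘ σ.symm ∈ rowSpace (expanderHZ Hᵀ) := he₀
  have hw' : (hammingNorm (e₀ ∘ σ.symm) : ℝ) ≤ 9 / 10 * min (γB * Fintype.card B) (γA * Fintype.card A) := by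
    rw [hammingNorm_comp_equiv, min_comm]; exact hw
  obtain ⟨f', hf', hwf'⟩ := ltz15_corollary9_nine_tenths Hᵀ hregT hexpT hdB hdA hδB hδB' hδA hδA' he₀' hw'
  refine ⟨f' ∘ σ, ?_, ?_⟩
  · rw [mem_rowSpace_submatrix_iff]
    have : (f' ∘ σ + e) ∘ σ.symm = f' + e ∘ σ.symm := by
      funext q; simp [Function.comp_apply]
    rw [this]; exact hf'
  · rw [submatrix_mulVec_eq]
    have : hammingNorm (f' ∘ ⇑σ) = hammingNorm f' := by
      have h := hammingNorm_comp_equiv (f' ∘ σ) σ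
      rw [← h]; congr 1; funext q; simp
    rw [this]; exact hwf'

end QuantumExpander

end Literature.InformationTheory.QuantumCodes
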